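import Summits.QuantumFields.YangMills.Theorems.UnitScaleTiltProp7GramNearRowOfCube
import HarnessLib

/-!
# Route `UnitScaleTilt`, crux K1 «MinimiserStabilityRegPr» (stmt-QuantumFields-19200), EX row `hGF[Lift]` (curved member) — LOD LINE, PEN (L5″) `hloc` PER CUBE,
# THE LETTER BOUNDS: **`cG`, `cQ`, `εN` OF ✓`Prop7LocalProjectorRowsRBOfCube.hRB1_of_cube`∕`hRB2_of_cube` (p761882) AND ✓`Prop7GramNearRowOfCube.hop_of_cube` (p762279) ARE
# BOUNDED, UNDER THE CHAIR'S PIN (2) `c₁ = c₀·(L³)^(K−n)`, BY K-FREE ONE-LINE EXPRESSIONS** `P(M,a)·ν + P′(M,a)·ε₀·(Rb + 9 + L²) (+ T(M)·e^(−μa(Bt−1)∕ν))`,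
# `M := max 2 (16∕a)` — the shape ✓`Prop7LocalProjectorRowCubeWindow.deltaPmax_le_of_budget`'s quarter budgets `hcG`∕`hcQ`∕`hεN` eat (px10 g11 04:59:02Z ask (2))

Cell `ym3-torus` (HUMAN RULING D-0037: YM₃ on T³ is ladder rung R3 — NOT d = 4, NOT infinite volume, NOT a mass gap, NOT Clay).  Width seat `ym-routeR-w3` (gen 13); px10 g11
04:59:02Z «(2) K-FREE LETTER BOUNDS … as separate one-line lemmas (whoever: you or routeR-w4 g27 — say MINE)» — routeR-w3 g13 CLAIM 05:18:05Z (routeR-w4 silent).  THEOREMS ONLY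
(0 `def`, 0 `sorry`); `--supports stmt-QuantumFields-19200 --as helper`, count-neutral.  HONEST LABEL (★★OWNER RULING №33 (6)): secondary-school real arithmetic on the printed
constants (`√3 ≤ 2`, `√24 ≤ 5`, `√2 ≤ 3∕2`, `√(25∕8) ≤ 2`, `(√(25∕8))² = 25∕8`, `24ε₀(Rb+9) ≤ 1`); nothing of `hloc`, `hlarge`, `hT`, `hGF`, EX or the crux is proved here.
HYP-SAT (★★OWNER RULING №42): the hypotheses here are `0 < c₀`, `0 < a`, `0 ≤ ν`, `0 ≤ ε₀`, `24ε₀(Rb+9) ≤ 1` and the pin — letters of ✓p760402's frame, all free∕chosen in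
this order on the literal T³ families; the three bounded constants are those of ✓p761882∕✓p762279, whose own side letters (`hRb` = definition of `Rb`; `hεRb`; `hwrap` = a WIDTH
condition, EVENTUALLY-n ONLY, `n ≥ ⌈log_L(2Rb+22)⌉`, folded by the caller's room lemma; the window `hδw`∕`hwin` at slope `μa`, satisfiable by `μa` small) are NOT used or
discharged here.

THE PIN.  Under `c₁ = c₀(L³)^(K−n)`: `κ := c₁·((L^d)^(K−n))⁻¹∕c₀ = 1` ((F.P K).d = 3, (F.P K).L = F.L by `rfl`), `C_P² := max 2 (16c₀ℓ³∕(a c₁)) = max 2 (16∕a) =: M`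
(`ℓ³ = (L^(K−n))³ = (L³)^(K−n)`), and `η⁻¹·(ν·η) = ν`; after these three rewrites the constants are polynomials in `√M, M, a, ν, ε₀, Rb, L², √3, √24, √2, √(25∕8),
e^(−μa(Bt−1)∕ν)` with nonnegative coefficients, bounded monomial by monomial (`linarith` on products supplied by hand).

WHAT IS PROVED (ns `…Theorems.Prop7LocalProjectorRowCubeLetterBounds`; `u := ε₀(Rb+9)`, `q := L²ε₀`, `E := e^(−μa(Bt−1)∕ν)`, `r := √M`).
* `kappa_eq_one`, `massGap_eq` (`C_P² = M`), `eta_inv_mul` — the pin rewrites.  * `cutoffComm_le` — `A := √3ν + 2√24·ε₀(Rb+7) + 4√3√24·ν·ε₀(Rb+7) ≤ 4ν + 10u`.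
* ★★ `cG_le` — `cG ≤ PG₁·ν + PG₂·ε₀·(Rb + 9 + L²)`, `PG₁ := r(1+r)(8(r+M) + 38aM)`, `PG₂ := r(1+r)(20(r+M) + 54576aM)`.
* ★★ `cQ_le` — `cQ ≤ PQ·ε₀·(Rb + 9 + L²) + TQ·E`, `PQ := 13500M`, `TQ := 32M`.
* ★★ `epsN_le` — `εN ≤ PN₁·ν + PN₂·ε₀·(Rb + 9 + L²) + TN·E`, `PN₁ := (25∕4)M·PG₁`, `PN₂ := (25∕4)M·PG₂ + 54576M²`, `TN := 450M²`.
* `coeff_nonneg` — `0 ≤ PG₁, PG₂, PQ, TQ, PN₁, PN₂, TN` (for ✓`Prop7LODBudgetLetters.exists_budget_letters`' hypotheses).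
SHAPES = routeR-w4 g27's ✓`exists_budget_letters` conclusions VERBATIM with `W₀ := (F.L : ℝ) ^ 2` (`P * ν + P′ * ε₀ * ((Rb : ℝ) + 9 + W₀) + T * Real.exp (-(μa * ((Bt - 1) / ν)))`).
LHS = the constants of ✓p761882∕✓p762279 VERBATIM (script-generated from the tree statements), so the caller chains `hRB1_of_cube …` with `cG_le` by
`le_trans` ∕ `mul_le_mul_of_nonneg_right` and feeds ✓`deltaPmax_le_of_budget`.

References: T. Bałaban, CMP **99** (1985) 389–434 [Balaban1985BackgroundPropagators] ((3.24)–(3.26) pp.394–395, (3.49) p.399); CMP **98** (1985) 17–51 [Balaban1985Averaging] ((97) p.32).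
-/

set_option autoImplicit false
noncomputable section

namespace Summit.QuantumFields.YangMills.Theorems.Prop7LocalProjectorRowCubeLetterBounds

open Literature.MathematicalPhysics.QuantumFieldTheory.Balaban1983to89
open Literature.MathematicalPhysics.QuantumFieldTheory.Balaban1983to89.T3ContinuumYM3Torus
open T3SectALandauChart (eta eta_pos)

variable (F : T3Family) {n K : ℕ} {c₀ c₁ : ℝ}

/-! ## §1 The pin rewrites -/

/-- Under the pin `c₁ = c₀(L³)^(K−n)` the coarse weight ratio `κ = c₁·((L^d)^(K−n))⁻¹∕c₀` of px5's constants equals `1`. -/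
theorem kappa_eq_one (hc₁ : c₁ = c₀ * ((F.L : ℝ) ^ 3) ^ (K - n)) (hc₀ : 0 < c₀) :
    (c₁ * ((((F.P K).L : ℝ) ^ (F.P K).d) ^ (K - n))⁻¹ / c₀) = 1 := by
  have hd : (F.P K).d = 3 := rfl
  have hL : (F.P K).L = F.L := rfl
  rw [hd, hL, hc₁]
  have hL1 : (1 : ℝ) < (F.L : ℝ) := by exact_mod_cast F.hL.2
  have hx : (0 : ℝ) < ((F.L : ℝ) ^ 3) ^ (K - n) := by positivity
  field_simp

/-- Under the pin the massive-propagator constant `C_P² = max 2 (16c₀ℓ³∕(a c₁))` equals `M := max 2 (16∕a)` (`ℓ³ = (L³)^(K−n)`). -/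
theorem massGap_eq (hc₁ : c₁ = c₀ * ((F.L : ℝ) ^ 3) ^ (K - n)) (hc₀ : 0 < c₀) {a : ℝ} (ha : 0 < a) :
    max 2 (16 * c₀ * ((F.L : ℝ) ^ (K - n)) ^ 3 / (a * c₁)) = max 2 (16 / a) := by
  have hL1 : (1 : ℝ) < (F.L : ℝ) := by exact_mod_cast F.hL.2
  have hpow : ((F.L : ℝ) ^ (K - n)) ^ 3 = ((F.L : ℝ) ^ 3) ^ (K - n) := by rw [← pow_mul, ← pow_mul, mul_comm]
  have hx : (0 : ℝ) < ((F.L : ℝ) ^ 3) ^ (K - n) := by positivity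
  rw [hc₁, hpow]
  congr 1
  field_simp

/-- The cut-off slope letter: `x·η⁻¹·(ν·η) = x·ν` (as printed, left-associated). -/
theorem eta_inv_mul (x ν : ℝ) : x * (eta F n K)⁻¹ * (ν * eta F n K) = x * ν := by
  have hη := eta_pos F n K
  field_simp

/-! ## §2 The cut-off commutator bracket -/

/-- `A := √3·ν + √24·2ε₀(Rb+7) + 2(√3ν)(√24·2ε₀(Rb+7)) ≤ 4ν + 10·ε₀(Rb+9)` under `24ε₀(Rb+9) ≤ 1` (`√3 ≤ 2`, `√24 ≤ 5`, `40·ν·ε₀(Rb+7) ≤ 40ν∕24 ≤ 2ν`). -/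
theorem cutoffComm_le {ν ε₀ : ℝ} (hν : 0 ≤ ν) (hε₀ : 0 ≤ ε₀) (Rb : ℕ) (hεRb : 24 * ε₀ * ((Rb : ℝ) + 9) ≤ 1) :
    (Real.sqrt 3 * ν + Real.sqrt 24 * (2 * ε₀ * ((Rb : ℝ) + 7)) + 2 * (Real.sqrt 3 * ν) * (Real.sqrt 24 * (2 * ε₀ * ((Rb : ℝ) + 7)))) ≤ 4 * ν + 10 * (ε₀ * ((Rb : ℝ) + 9)) := by
  have hS3 : Real.sqrt 3 ≤ 2 := by
    have h := Real.sqrt_le_sqrt (show (3 : ℝ) ≤ 2 ^ 2 by norm_num)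
    rwa [Real.sqrt_sq (by norm_num : (0 : ℝ) ≤ 2)] at h
  have hS24 : Real.sqrt 24 ≤ 5 := by
    have h := Real.sqrt_le_sqrt (show (24 : ℝ) ≤ 5 ^ 2 by norm_num)
    rwa [Real.sqrt_sq (by norm_num : (0 : ℝ) ≤ 5)] at h
  have hS3n : 0 ≤ Real.sqrt 3 := Real.sqrt_nonneg _
  have hS24n : 0 ≤ Real.sqrt 24 := Real.sqrt_nonneg _
  have hRb : (0 : ℝ) ≤ (Rb : ℝ) := Nat.cast_nonneg _
  have hw : 0 ≤ 2 * ε₀ * ((Rb : ℝ) + 7) := by positivity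
  have hwu : 2 * ε₀ * ((Rb : ℝ) + 7) ≤ 2 * (ε₀ * ((Rb : ℝ) + 9)) := by nlinarith
  have hu : ε₀ * ((Rb : ℝ) + 9) ≤ 1 / 24 := by linarith
  have h1 : Real.sqrt 3 * ν ≤ 2 * ν := mul_le_mul_of_nonneg_right hS3 hν
  have h2 : Real.sqrt 24 * (2 * ε₀ * ((Rb : ℝ) + 7)) ≤ 5 * (2 * (ε₀ * ((Rb : ℝ) + 9))) :=
    mul_le_mul hS24 hwu hw (by norm_num)
  have h3 : 2 * (Real.sqrt 3 * ν) * (Real.sqrt 24 * (2 * ε₀ * ((Rb : ℝ) + 7))) ≤ 2 * (2 * ν) * (5 * (2 * (ε₀ * ((Rb : ℝ) + 9)))) :=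
    mul_le_mul (mul_le_mul_of_nonneg_left h1 (by norm_num)) h2 (mul_nonneg hS24n hw) (by positivity)
  have h4 : ν * (ε₀ * ((Rb : ℝ) + 9)) ≤ ν * (1 / 24) := mul_le_mul_of_nonneg_left hu hν
  nlinarith [h1, h2, h3, h4]

/-! ## §3 The three letter bounds -/

/-- ★★ **`cG` IS K-FREE-BOUNDED**: the constant of ✓`Prop7LocalProjectorRowsRBOfCube.hRB1_of_cube` (verbatim), under the pin `c₁ = c₀(L³)^(K−n)`, is at most
`PG₁·ν + PG₂·ε₀·(Rb + 9 + L²)` with `PG₁ = √M(1+√M)(8(√M+M) + 38aM)`, `PG₂ = √M(1+√M)(20(√M+M) + 54576aM)`, `M = max 2 (16∕a)`: `O(ν)` (cut-off commutator)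
`+ O(ε₀(Rb + L²))` (flatness), MONOTONE in `ν, ε₀` — routeR-w4 g27's ✓`exists_budget_letters` shape with `W₀ := L²`. [cite: Balaban1985BackgroundPropagators, (3.24)–(3.26) pp.394–395] -/
theorem cG_le (hc₁ : c₁ = c₀ * ((F.L : ℝ) ^ 3) ^ (K - n)) (hc₀ : 0 < c₀) {a : ℝ} (ha : 0 < a)
    {ν ε₀ : ℝ} (hν : 0 ≤ ν) (hε₀ : 0 ≤ ε₀) (Rb : ℕ) (hεRb : 24 * ε₀ * ((Rb : ℝ) + 9) ≤ 1) :
    (Real.sqrt (max 2 (16 * c₀ * ((F.L : ℝ) ^ (K - n)) ^ 3 / (a * c₁)))⁻¹⁻¹ * (1 + Real.sqrt (max 2 (16 * c₀ * ((F.L : ℝ) ^ (K - n)) ^ 3 / (a * c₁)))⁻¹⁻¹) * ((Real.sqrt 3 * (eta F n K)⁻¹ * (ν * eta F n K) + Real.sqrt 24 * (2 * ε₀ * ((Rb : ℝ) + 7)) + 2 * (Real.sqrt 3 * (eta F n K)⁻¹ * (ν * eta F n K)) * (Real.sqrt 24 * (2 * ε₀ * ((Rb : ℝ) + 7)))) *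 Real.sqrt (max 2 (16 * c₀ * ((F.L : ℝ) ^ (K - n)) ^ 3 / (a * c₁)))⁻¹⁻¹ + ((Real.sqrt 3 * (eta F n K)⁻¹ * (ν * eta F n K) + Real.sqrt 24 * (2 * ε₀ * ((Rb : ℝ) + 7)) + 2 * (Real.sqrt 3 * (eta F n K)⁻¹ * (ν * eta F n K)) * (Real.sqrt 24 * (2 * ε₀ * ((Rb : ℝ) + 7)))) + a * ((25 / 4) * (c₁ * ((((F.P K).L : ℝ) ^ (F.P K).d) ^ (K - n))⁻¹ / c₀) * (3 * ν) + 2 * Real.sqrt ((25 / 8) * (c₁ * ((((F.P K).L : ℝ) ^ (F.P K).d) ^ (K - n))⁻¹ / c₀)) * (Real.sqrt (2 * (c₁ * ((((F.P K).L : ℝ) ^ (F.P K).d) ^ (K - n))⁻¹ / c₀)) * (2 * (4500 * (F.L : ℝ) ^ 2 * ε₀) + 2 * 0 + 2 * (48 * ε₀ * ((Rb : ℝ) + 9)))))) * (max 2 (16 * c₀ * ((F.L : ℝ) ^ (K - n)) ^ 3 / (a * c₁)))⁻¹⁻¹)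
      + Real.sqrt (max 2 (16 * c₀ * ((F.L : ℝ) ^ (K - n)) ^ 3 / (a * c₁)))⁻¹⁻¹ * (1 + Real.sqrt (max 2 (16 * c₀ * ((F.L : ℝ) ^ (K - n)) ^ 3 / (a * c₁)))⁻¹⁻¹) * ((Real.sqrt 3 * (eta F n K)⁻¹ * (ν * eta F n K) + Real.sqrt 24 * (2 * ε₀ * ((Rb : ℝ) + 7)) + 2 * (Real.sqrt 3 * (eta F n K)⁻¹ * (ν * eta F n K)) * (Real.sqrt 24 * (2 * ε₀ * ((Rb : ℝ) + 7)))) * Real.sqrt (max 2 (16 * c₀ * ((F.L : ℝ) ^ (K - n)) ^ 3 / (a * c₁)))⁻¹⁻¹ + ((Real.sqrt 3 * (eta F n K)⁻¹ * (ν * eta F n K) + Real.sqrt 24 * (2 * ε₀ * ((Rb : ℝ) + 7)) + 2 * (Real.sqrt 3 * (eta F n K)⁻¹ * (ν * eta F n K)) * (Real.sqrt 24 * (2 * ε₀ * ((Rb : ℝ) + 7)))) + a * ((25 / 4) * (c₁ * ((((F.P K).L : ℝ) ^ (F.P K).d) ^ (K - n))⁻¹ / c₀) * (3 * ν) + 2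 * Real.sqrt ((25 / 8) * (c₁ * ((((F.P K).L : ℝ) ^ (F.P K).d) ^ (K - n))⁻¹ / c₀)) * 0)) * (max 2 (16 * c₀ * ((F.L : ℝ) ^ (K - n)) ^ 3 / (a * c₁)))⁻¹⁻¹))
      ≤ (Real.sqrt (max 2 (16 / a)) * (1 + Real.sqrt (max 2 (16 / a))) * (8 * (Real.sqrt (max 2 (16 / a)) + max 2 (16 / a)) + 38 * a * max 2 (16 / a))) * ν + (Real.sqrt (max 2 (16 / a)) * (1 + Real.sqrt (max 2 (16 / a))) * (20 * (Real.sqrt (max 2 (16 / a)) + max 2 (16 / a)) + 54576 * a * max 2 (16 / a))) * ε₀ * ((Rb : ℝ) + 9 + (F.L : ℝ) ^ 2) := by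
  have hA := cutoffComm_le hν hε₀ Rb hεRb
  rw [kappa_eq_one F hc₁ hc₀, massGap_eq F hc₁ hc₀ ha, eta_inv_mul F (n := n) (K := K) (Real.sqrt 3) ν]
  simp only [inv_inv, mul_one, mul_zero, add_zero]
  have hM0 : (0 : ℝ) ≤ max 2 (16 / a) := le_trans (by norm_num) (le_max_left _ _)
  have hr0 : 0 ≤ Real.sqrt (max 2 (16 / a)) := Real.sqrt_nonneg _
  have hrr : Real.sqrt (max 2 (16 / a)) * Real.sqrt (max 2 (16 / a)) = max 2 (16 / a) := Real.mul_self_sqrt hM0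
  have hS2 : Real.sqrt 2 ≤ 3 / 2 := by
    have h := Real.sqrt_le_sqrt (show (2 : ℝ) ≤ (3 / 2) ^ 2 by norm_num)
    rwa [Real.sqrt_sq (by norm_num : (0 : ℝ) ≤ 3 / 2)] at h
  have hs : Real.sqrt (25 / 8) ≤ 2 := by
    have h := Real.sqrt_le_sqrt (show (25 / 8 : ℝ) ≤ 2 ^ 2 by norm_num)
    rwa [Real.sqrt_sq (by norm_num : (0 : ℝ) ≤ 2)] at h
  have hsS2 : Real.sqrt (25 / 8) * Real.sqrt 2 ≤ 3 :=
    (mul_le_mul hs hS2 (Real.sqrt_nonneg _) (by norm_num)).trans (by norm_num)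
  have hRb : (0 : ℝ) ≤ (Rb : ℝ) := Nat.cast_nonneg _
  have hQ0 : 0 ≤ (2 * (4500 * (F.L : ℝ) ^ 2 * ε₀) + 2 * (48 * ε₀ * ((Rb : ℝ) + 9))) := by positivity
  have hA0 : 0 ≤ (Real.sqrt 3 * ν + Real.sqrt 24 * (2 * ε₀ * ((Rb : ℝ) + 7)) + 2 * (Real.sqrt 3 * ν) * (Real.sqrt 24 * (2 * ε₀ * ((Rb : ℝ) + 7)))) := by
    have := Real.sqrt_nonneg (3 : ℝ); have := Real.sqrt_nonneg (24 : ℝ); positivity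
  -- the three hand-multiplied rows
  have F1 : Real.sqrt (max 2 (16 / a)) * (1 + Real.sqrt (max 2 (16 / a))) * (2 * Real.sqrt (max 2 (16 / a)) + 2 * max 2 (16 / a)) * (Real.sqrt 3 * ν + Real.sqrt 24 * (2 * ε₀ * ((Rb : ℝ) + 7)) + 2 * (Real.sqrt 3 * ν) * (Real.sqrt 24 * (2 * ε₀ * ((Rb : ℝ) + 7))))
      ≤ Real.sqrt (max 2 (16 / a)) * (1 + Real.sqrt (max 2 (16 / a))) * (2 * Real.sqrt (max 2 (16 / a)) + 2 * max 2 (16 / a)) * (4 * ν + 10 * (ε₀ * ((Rb : ℝ) + 9))) :=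
    mul_le_mul_of_nonneg_left hA (by positivity)
  have F2 : Real.sqrt (max 2 (16 / a)) * (1 + Real.sqrt (max 2 (16 / a))) * a * max 2 (16 / a) * 2 * (2 * (4500 * (F.L : ℝ) ^ 2 * ε₀) + 2 * (48 * ε₀ * ((Rb : ℝ) + 9))) * (Real.sqrt (25 / 8) * Real.sqrt 2)
      ≤ Real.sqrt (max 2 (16 / a)) * (1 + Real.sqrt (max 2 (16 / a))) * a * max 2 (16 / a) * 2 * (2 * (4500 * (F.L : ℝ) ^ 2 * ε₀) + 2 * (48 * ε₀ * ((Rb : ℝ) + 9))) * 3 :=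
    mul_le_mul_of_nonneg_left hsS2 (by positivity)
  have F3 : 0 ≤ Real.sqrt (max 2 (16 / a)) * (1 + Real.sqrt (max 2 (16 / a))) * a * max 2 (16 / a) * ν := by positivity
  have F4 : 0 ≤ Real.sqrt (max 2 (16 / a)) * (1 + Real.sqrt (max 2 (16 / a))) * a * max 2 (16 / a) * (ε₀ * ((Rb : ℝ) + 9)) := by positivity
  have F5 : 0 ≤ Real.sqrt (max 2 (16 / a)) * (1 + Real.sqrt (max 2 (16 / a))) * (Real.sqrt (max 2 (16 / a)) + max 2 (16 / a)) * ((F.L : ℝ) ^ 2 * ε₀) := by positivity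
  have F6 : 0 ≤ Real.sqrt (max 2 (16 / a)) * (1 + Real.sqrt (max 2 (16 / a))) * a * max 2 (16 / a) * ((F.L : ℝ) ^ 2 * ε₀) := by positivity
  linarith only [F1, F2, F3, F4, F5, F6]

/-- ★★ **`cQ` IS K-FREE-BOUNDED**: the constant of ✓`Prop7LocalProjectorRowsRBOfCube.hRB2_of_cube` (verbatim), under the pin, is at most
`PQ·ε₀·(Rb + 9 + L²) + TQ·e^(−μa(Bt−1)∕ν)`, `PQ = 13500M`, `TQ = 32M`, `M = max 2 (16∕a)`. [cite: Balaban1985BackgroundPropagators, (3.49) p.399; Balaban1985Averaging, (97) p.32] -/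
theorem cQ_le (hc₁ : c₁ = c₀ * ((F.L : ℝ) ^ 3) ^ (K - n)) (hc₀ : 0 < c₀) {a : ℝ} (ha : 0 < a)
    {ν ε₀ : ℝ} (hε₀ : 0 ≤ ε₀) (Rb : ℕ) (μa Bt : ℝ) :
    (Real.sqrt (2 * (c₁ * ((((F.P K).L : ℝ) ^ (F.P K).d) ^ (K - n))⁻¹ / c₀)) * (2 * (4500 * (F.L : ℝ) ^ 2 * ε₀) + 96 * ε₀ * ((Rb : ℝ) + 9)) * (max 2 (16 * c₀ * ((F.L : ℝ) ^ (K - n)) ^ 3 / (a * c₁))) + 2 * Real.sqrt ((25 / 8) * (c₁ * ((((F.P K).L : ℝ) ^ (F.P K).d) ^ (K - n))⁻¹ / c₀)) * (Real.exp (-(μa * ((Bt - 1) / ν))) * (8 * Real.sqrt (max 2 (16 * c₀ * ((F.L : ℝ) ^ (K - n)) ^ 3 / (a * c₁))) ^ 2)))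
      ≤ (13500 * max 2 (16 / a)) * ε₀ * ((Rb : ℝ) + 9 + (F.L : ℝ) ^ 2) + (32 * max 2 (16 / a)) * Real.exp (-(μa * ((Bt - 1) / ν))) := by
  rw [kappa_eq_one F hc₁ hc₀, massGap_eq F hc₁ hc₀ ha]
  have hM0 : (0 : ℝ) ≤ max 2 (16 / a) := le_trans (by norm_num) (le_max_left _ _)
  simp only [mul_one, Real.sq_sqrt hM0]
  have hS2 : Real.sqrt 2 ≤ 3 / 2 := by
    have h := Real.sqrt_le_sqrt (show (2 : ℝ) ≤ (3 / 2) ^ 2 by norm_num)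
    rwa [Real.sqrt_sq (by norm_num : (0 : ℝ) ≤ 3 / 2)] at h
  have hs : Real.sqrt (25 / 8) ≤ 2 := by
    have h := Real.sqrt_le_sqrt (show (25 / 8 : ℝ) ≤ 2 ^ 2 by norm_num)
    rwa [Real.sqrt_sq (by norm_num : (0 : ℝ) ≤ 2)] at h
  have hRb : (0 : ℝ) ≤ (Rb : ℝ) := Nat.cast_nonneg _
  have hE0 : 0 ≤ Real.exp (-(μa * ((Bt - 1) / ν))) := (Real.exp_pos _).le
  have G1 : Real.sqrt 2 * ((2 * (4500 * (F.L : ℝ) ^ 2 * ε₀) + 96 * ε₀ * ((Rb : ℝ) + 9)) * max 2 (16 / a))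
      ≤ 3 / 2 * ((2 * (4500 * (F.L : ℝ) ^ 2 * ε₀) + 96 * ε₀ * ((Rb : ℝ) + 9)) * max 2 (16 / a)) :=
    mul_le_mul_of_nonneg_right hS2 (by positivity)
  have G2 : Real.sqrt (25 / 8) * (Real.exp (-(μa * ((Bt - 1) / ν))) * max 2 (16 / a))
      ≤ 2 * (Real.exp (-(μa * ((Bt - 1) / ν))) * max 2 (16 / a)) :=
    mul_le_mul_of_nonneg_right hs (by positivity)
  have G3 : 0 ≤ max 2 (16 / a) * (ε₀ * ((Rb : ℝ) + 9)) := by positivity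
  linarith only [G1, G2, G3]

/-- ★★ **`εN` IS K-FREE-BOUNDED**: the constant of ✓`Prop7GramNearRowOfCube.hop_of_cube` (verbatim), under the pin, is at most
`PN₁·ν + PN₂·ε₀·(Rb + 9 + L²) + TN·e^(−μa(Bt−1)∕ν)`, `PN₁ = (25∕4)M·PG₁`, `PN₂ = (25∕4)M·PG₂ + 54576M²`, `TN = 450M²`, `M = max 2 (16∕a)`
(`εN = 2√(25∕8)√2·Q·M² + 2(25∕8)·M·cG + 144(25∕8)·M²·E` exactly, `Q = 9000L²ε₀ + 96ε₀(Rb+9)`).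
[cite: Balaban1985BackgroundPropagators, (3.24)–(3.26) pp.394–395, (3.49) p.399] -/
theorem epsN_le (hc₁ : c₁ = c₀ * ((F.L : ℝ) ^ 3) ^ (K - n)) (hc₀ : 0 < c₀) {a : ℝ} (ha : 0 < a)
    {ν ε₀ : ℝ} (hν : 0 ≤ ν) (hε₀ : 0 ≤ ε₀) (Rb : ℕ) (hεRb : 24 * ε₀ * ((Rb : ℝ) + 9) ≤ 1) (μa Bt : ℝ) :
    ((Real.sqrt (2 * (c₁ * ((((F.P K).L : ℝ) ^ (F.P K).d) ^ (K - n))⁻¹ / c₀)) * (2 * (4500 * (F.L : ℝ) ^ 2 * ε₀) + 96 * ε₀ * ((Rb : ℝ) + 9))) * ((max 2 (16 * c₀ * ((F.L : ℝ) ^ (K - n)) ^ 3 / (a * c₁))) ^ 2 * Real.sqrt ((25 / 8) * (c₁ * ((((F.P K).L : ℝ) ^ (F.P K).d) ^ (K - n))⁻¹ / c₀))) + (2 * Real.sqrt ((25 / 8) * (c₁ * ((((F.P K).L : ℝ) ^ (F.P K).d) ^ (K - n))⁻¹ / c₀))) * (Real.exp (-(μa * ((Bt - 1) / ν))) * (8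 * Real.sqrt (max 2 (16 * c₀ * ((F.L : ℝ) ^ (K - n)) ^ 3 / (a * c₁))) ^ 2) ^ 2 * Real.sqrt ((25 / 8) * (c₁ * ((((F.P K).L : ℝ) ^ (F.P K).d) ^ (K - n))⁻¹ / c₀))) + Real.sqrt ((25 / 8) * (c₁ * ((((F.P K).L : ℝ) ^ (F.P K).d) ^ (K - n))⁻¹ / c₀)) * ((Real.sqrt (max 2 (16 * c₀ * ((F.L : ℝ) ^ (K - n)) ^ 3 / (a * c₁)))⁻¹⁻¹ * (1 + Real.sqrt (max 2 (16 * c₀ * ((F.L : ℝ) ^ (K - n)) ^ 3 / (a * c₁)))⁻¹⁻¹) * ((Real.sqrt 3 * (eta F n K)⁻¹ * (ν * eta F n K) + Real.sqrt 24 * (2 * ε₀ * ((Rb : ℝ) + 7)) + 2 * (Real.sqrt 3 * (eta F n K)⁻¹ * (ν * eta F n K)) * (Real.sqrt 24 * (2 * ε₀ * ((Rb : ℝ) + 7)))) * Real.sqrt (max 2 (16 * c₀ * ((F.L : ℝ) ^ (K - n)) ^ 3 / (a * c₁)))⁻¹⁻¹ + ((Real.sqrt 3 * (eta F n K)⁻¹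 * (ν * eta F n K) + Real.sqrt 24 * (2 * ε₀ * ((Rb : ℝ) + 7)) + 2 * (Real.sqrt 3 * (eta F n K)⁻¹ * (ν * eta F n K)) * (Real.sqrt 24 * (2 * ε₀ * ((Rb : ℝ) + 7)))) + a * ((25 / 4) * (c₁ * ((((F.P K).L : ℝ) ^ (F.P K).d) ^ (K - n))⁻¹ / c₀) * (3 * ν) + 2 * Real.sqrt ((25 / 8) * (c₁ * ((((F.P K).L : ℝ) ^ (F.P K).d) ^ (K - n))⁻¹ / c₀)) * (Real.sqrt (2 * (c₁ * ((((F.P K).L : ℝ) ^ (F.P K).d) ^ (K - n))⁻¹ / c₀)) * (2 * (4500 * (F.L : ℝ) ^ 2 * ε₀) + 2 * 0 + 2 * (48 * ε₀ * ((Rb : ℝ) + 9)))))) * (max 2 (16 * c₀ * ((F.L : ℝ) ^ (K - n)) ^ 3 / (a * c₁)))⁻¹⁻¹) + Real.sqrt (max 2 (16 * c₀ * ((F.L : ℝ) ^ (K - n)) ^ 3 / (a * c₁)))⁻¹⁻¹ * (1 + Real.sqrt (max 2 (16 * c₀ * ((F.L : ℝ) ^ (K - n)) ^ 3 / (a * c₁)))⁻¹⁻¹)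 * ((Real.sqrt 3 * (eta F n K)⁻¹ * (ν * eta F n K) + Real.sqrt 24 * (2 * ε₀ * ((Rb : ℝ) + 7)) + 2 * (Real.sqrt 3 * (eta F n K)⁻¹ * (ν * eta F n K)) * (Real.sqrt 24 * (2 * ε₀ * ((Rb : ℝ) + 7)))) * Real.sqrt (max 2 (16 * c₀ * ((F.L : ℝ) ^ (K - n)) ^ 3 / (a * c₁)))⁻¹⁻¹ + ((Real.sqrt 3 * (eta F n K)⁻¹ * (ν * eta F n K) + Real.sqrt 24 * (2 * ε₀ * ((Rb : ℝ) + 7)) + 2 * (Real.sqrt 3 * (eta F n K)⁻¹ * (ν * eta F n K)) * (Real.sqrt 24 * (2 * ε₀ * ((Rb : ℝ) + 7)))) + a * ((25 / 4) * (c₁ * ((((F.P K).L : ℝ) ^ (F.P K).d) ^ (K - n))⁻¹ / c₀) * (3 * ν) + 2 * Real.sqrt ((25 / 8) * (c₁ * ((((F.P K).L : ℝ) ^ (F.P K).d) ^ (K - n))⁻¹ / c₀)) * 0)) * (max 2 (16 * c₀ * ((F.L : ℝ) ^ (K - n)) ^ 3 / (a * c₁)))⁻¹⁻¹)) * ((max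 2 (16 * c₀ * ((F.L : ℝ) ^ (K - n)) ^ 3 / (a * c₁))) * Real.sqrt ((25 / 8) * (c₁ * ((((F.P K).L : ℝ) ^ (F.P K).d) ^ (K - n))⁻¹ / c₀)))
      + 2 * (max 2 (16 * c₀ * ((F.L : ℝ) ^ (K - n)) ^ 3 / (a * c₁))) * (Real.exp (-(μa * ((Bt - 1) / ν))) * (8 * Real.sqrt (max 2 (16 * c₀ * ((F.L : ℝ) ^ (K - n)) ^ 3 / (a * c₁))) ^ 2) * Real.sqrt ((25 / 8) * (c₁ * ((((F.P K).L : ℝ) ^ (F.P K).d) ^ (K - n))⁻¹ / c₀))) + (max 2 (16 * c₀ * ((F.L : ℝ) ^ (K - n)) ^ 3 / (a * c₁))) * ((Real.sqrt (max 2 (16 * c₀ * ((F.L : ℝ) ^ (K - n)) ^ 3 / (a * c₁)))⁻¹⁻¹ * (1 + Real.sqrt (max 2 (16 * c₀ * ((F.L : ℝ) ^ (K - n)) ^ 3 / (a * c₁)))⁻¹⁻¹) * ((Real.sqrt 3 * (eta F n K)⁻¹ * (ν * eta F n K) + Real.sqrt 24 * (2 * ε₀ * ((Rb : ℝ) + 7))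 + 2 * (Real.sqrt 3 * (eta F n K)⁻¹ * (ν * eta F n K)) * (Real.sqrt 24 * (2 * ε₀ * ((Rb : ℝ) + 7)))) * Real.sqrt (max 2 (16 * c₀ * ((F.L : ℝ) ^ (K - n)) ^ 3 / (a * c₁)))⁻¹⁻¹ + ((Real.sqrt 3 * (eta F n K)⁻¹ * (ν * eta F n K) + Real.sqrt 24 * (2 * ε₀ * ((Rb : ℝ) + 7)) + 2 * (Real.sqrt 3 * (eta F n K)⁻¹ * (ν * eta F n K)) * (Real.sqrt 24 * (2 * ε₀ * ((Rb : ℝ) + 7)))) + a * ((25 / 4) * (c₁ * ((((F.P K).L : ℝ) ^ (F.P K).d) ^ (K - n))⁻¹ / c₀) * (3 * ν) + 2 * Real.sqrt ((25 / 8) * (c₁ * ((((F.P K).L : ℝ) ^ (F.P K).d) ^ (K - n))⁻¹ / c₀)) * (Real.sqrt (2 * (c₁ * ((((F.P K).L : ℝ) ^ (F.P K).d) ^ (K - n))⁻¹ / c₀)) * (2 * (4500 * (F.L : ℝ) ^ 2 * ε₀) + 2 * 0 + 2 * (48 * ε₀ * ((Rb : ℝ) + 9)))))) * (max 2 (16 *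 c₀ * ((F.L : ℝ) ^ (K - n)) ^ 3 / (a * c₁)))⁻¹⁻¹) + Real.sqrt (max 2 (16 * c₀ * ((F.L : ℝ) ^ (K - n)) ^ 3 / (a * c₁)))⁻¹⁻¹ * (1 + Real.sqrt (max 2 (16 * c₀ * ((F.L : ℝ) ^ (K - n)) ^ 3 / (a * c₁)))⁻¹⁻¹) * ((Real.sqrt 3 * (eta F n K)⁻¹ * (ν * eta F n K) + Real.sqrt 24 * (2 * ε₀ * ((Rb : ℝ) + 7)) + 2 * (Real.sqrt 3 * (eta F n K)⁻¹ * (ν * eta F n K)) * (Real.sqrt 24 * (2 * ε₀ * ((Rb : ℝ) + 7)))) * Real.sqrt (max 2 (16 * c₀ * ((F.L : ℝ) ^ (K - n)) ^ 3 / (a * c₁)))⁻¹⁻¹ + ((Real.sqrt 3 * (eta F n K)⁻¹ * (ν * eta F n K) + Real.sqrt 24 * (2 * ε₀ * ((Rb : ℝ) + 7)) + 2 * (Real.sqrt 3 * (eta F n K)⁻¹ * (ν * eta F n K)) * (Real.sqrt 24 * (2 * ε₀ * ((Rb : ℝ) + 7)))) + a * ((25 / 4) * (c₁ * ((((F.P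 K).L : ℝ) ^ (F.P K).d) ^ (K - n))⁻¹ / c₀) * (3 * ν) + 2 * Real.sqrt ((25 / 8) * (c₁ * ((((F.P K).L : ℝ) ^ (F.P K).d) ^ (K - n))⁻¹ / c₀)) * 0)) * (max 2 (16 * c₀ * ((F.L : ℝ) ^ (K - n)) ^ 3 / (a * c₁)))⁻¹⁻¹)) * Real.sqrt ((25 / 8) * (c₁ * ((((F.P K).L : ℝ) ^ (F.P K).d) ^ (K - n))⁻¹ / c₀)))
      + (max 2 (16 * c₀ * ((F.L : ℝ) ^ (K - n)) ^ 3 / (a * c₁))) ^ 2 * (Real.sqrt (2 * (c₁ * ((((F.P K).L : ℝ) ^ (F.P K).d) ^ (K - n))⁻¹ / c₀)) * (2 * (4500 * (F.L : ℝ) ^ 2 * ε₀) + 2 * 0 + 2 * (48 * ε₀ * ((Rb : ℝ) + 9))))))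
      ≤ (25 / 4 * max 2 (16 / a) * (Real.sqrt (max 2 (16 / a)) * (1 + Real.sqrt (max 2 (16 / a))) * (8 * (Real.sqrt (max 2 (16 / a)) + max 2 (16 / a)) + 38 * a * max 2 (16 / a)))) * ν + (25 / 4 * max 2 (16 / a) * (Real.sqrt (max 2 (16 / a)) * (1 + Real.sqrt (max 2 (16 / a))) * (20 * (Real.sqrt (max 2 (16 / a)) + max 2 (16 / a)) + 54576 * a * max 2 (16 / a))) + 54576 * max 2 (16 / a) ^ 2) * ε₀ * ((Rb : ℝ) + 9 + (F.L : ℝ) ^ 2)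
        + (450 * max 2 (16 / a) ^ 2) * Real.exp (-(μa * ((Bt - 1) / ν))) := by
  have hcG := cG_le F hc₁ hc₀ ha hν hε₀ Rb hεRb
  generalize hG : (Real.sqrt (max 2 (16 * c₀ * ((F.L : ℝ) ^ (K - n)) ^ 3 / (a * c₁)))⁻¹⁻¹ * (1 + Real.sqrt (max 2 (16 * c₀ * ((F.L : ℝ) ^ (K - n)) ^ 3 / (a * c₁)))⁻¹⁻¹) * ((Real.sqrt 3 * (eta F n K)⁻¹ * (ν * eta F n K) + Real.sqrt 24 * (2 * ε₀ * ((Rb : ℝ) + 7)) + 2 * (Real.sqrt 3 * (eta F n K)⁻¹ * (ν * eta F n K)) * (Real.sqrt 24 * (2 * ε₀ * ((Rb : ℝ) + 7)))) * Real.sqrt (max 2 (16 * c₀ * ((F.L : ℝ) ^ (K - n)) ^ 3 / (a * c₁)))⁻¹⁻¹ + ((Real.sqrt 3 * (eta F n K)⁻¹ * (ν * eta F n K) + Real.sqrt 24 * (2 * ε₀ * ((Rb : ℝ) + 7)) + 2 * (Real.sqrt 3 * (eta F n K)⁻¹ * (ν * eta F n K)) * (Real.sqrt 24 * (2 * ε₀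 * ((Rb : ℝ) + 7)))) + a * ((25 / 4) * (c₁ * ((((F.P K).L : ℝ) ^ (F.P K).d) ^ (K - n))⁻¹ / c₀) * (3 * ν) + 2 * Real.sqrt ((25 / 8) * (c₁ * ((((F.P K).L : ℝ) ^ (F.P K).d) ^ (K - n))⁻¹ / c₀)) * (Real.sqrt (2 * (c₁ * ((((F.P K).L : ℝ) ^ (F.P K).d) ^ (K - n))⁻¹ / c₀)) * (2 * (4500 * (F.L : ℝ) ^ 2 * ε₀) + 2 * 0 + 2 * (48 * ε₀ * ((Rb : ℝ) + 9)))))) * (max 2 (16 * c₀ * ((F.L : ℝ) ^ (K - n)) ^ 3 / (a * c₁)))⁻¹⁻¹) + Real.sqrt (max 2 (16 * c₀ * ((F.L : ℝ) ^ (K - n)) ^ 3 / (a * c₁)))⁻¹⁻¹ * (1 + Real.sqrt (max 2 (16 * c₀ * ((F.L : ℝ) ^ (K - n)) ^ 3 / (a * c₁)))⁻¹⁻¹) * ((Real.sqrt 3 * (eta F n K)⁻¹ * (ν * eta F n K) + Real.sqrt 24 * (2 * ε₀ * ((Rb : ℝ) + 7)) + 2 * (Real.sqrt 3 * (eta F n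 K)⁻¹ * (ν * eta F n K)) * (Real.sqrt 24 * (2 * ε₀ * ((Rb : ℝ) + 7)))) * Real.sqrt (max 2 (16 * c₀ * ((F.L : ℝ) ^ (K - n)) ^ 3 / (a * c₁)))⁻¹⁻¹ + ((Real.sqrt 3 * (eta F n K)⁻¹ * (ν * eta F n K) + Real.sqrt 24 * (2 * ε₀ * ((Rb : ℝ) + 7)) + 2 * (Real.sqrt 3 * (eta F n K)⁻¹ * (ν * eta F n K)) * (Real.sqrt 24 * (2 * ε₀ * ((Rb : ℝ) + 7)))) + a * ((25 / 4) * (c₁ * ((((F.P K).L : ℝ) ^ (F.P K).d) ^ (K - n))⁻¹ / c₀) * (3 * ν) + 2 * Real.sqrt ((25 / 8) * (c₁ * ((((F.P K).L : ℝ) ^ (F.P K).d) ^ (K - n))⁻¹ / c₀)) * 0)) * (max 2 (16 * c₀ * ((F.L : ℝ) ^ (K - n)) ^ 3 / (a * c₁)))⁻¹⁻¹)) = G at hcG ⊢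
  generalize hP₁ : (Real.sqrt (max 2 (16 / a)) * (1 + Real.sqrt (max 2 (16 / a))) * (8 * (Real.sqrt (max 2 (16 / a)) + max 2 (16 / a)) + 38 * a * max 2 (16 / a))) = P₁ at hcG ⊢
  generalize hP₂ : (Real.sqrt (max 2 (16 / a)) * (1 + Real.sqrt (max 2 (16 / a))) * (20 * (Real.sqrt (max 2 (16 / a)) + max 2 (16 / a)) + 54576 * a * max 2 (16 / a))) = P₂ at hcG ⊢
  rw [kappa_eq_one F hc₁ hc₀, massGap_eq F hc₁ hc₀ ha]
  have hM0 : (0 : ℝ) ≤ max 2 (16 / a) := le_trans (by norm_num) (le_max_left _ _)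
  simp only [mul_one, mul_zero, add_zero, Real.sq_sqrt hM0]
  have hS2 : Real.sqrt 2 ≤ 3 / 2 := by
    have h := Real.sqrt_le_sqrt (show (2 : ℝ) ≤ (3 / 2) ^ 2 by norm_num)
    rwa [Real.sqrt_sq (by norm_num : (0 : ℝ) ≤ 3 / 2)] at h
  have hs : Real.sqrt (25 / 8) ≤ 2 := by
    have h := Real.sqrt_le_sqrt (show (25 / 8 : ℝ) ≤ 2 ^ 2 by norm_num)
    rwa [Real.sqrt_sq (by norm_num : (0 : ℝ) ≤ 2)] at h
  have hss : Real.sqrt (25 / 8) * Real.sqrt (25 / 8) = 25 / 8 := Real.mul_self_sqrt (by norm_num)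
  have hsS2 : Real.sqrt (25 / 8) * Real.sqrt 2 ≤ 3 :=
    (mul_le_mul hs hS2 (Real.sqrt_nonneg _) (by norm_num)).trans (by norm_num)
  have hRb : (0 : ℝ) ≤ (Rb : ℝ) := Nat.cast_nonneg _
  have hE0 : 0 ≤ Real.exp (-(μa * ((Bt - 1) / ν))) := (Real.exp_pos _).le
  -- hand-multiplied rows
  have H1 : (Real.sqrt (25 / 8) * Real.sqrt 2) * ((2 * (4500 * (F.L : ℝ) ^ 2 * ε₀) + 2 * (48 * ε₀ * ((Rb : ℝ) + 9))) * max 2 (16 / a) ^ 2) ≤ 3 * ((2 * (4500 * (F.L : ℝ) ^ 2 * ε₀) + 2 * (48 * ε₀ * ((Rb : ℝ) + 9))) * max 2 (16 / a) ^ 2) :=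
    mul_le_mul_of_nonneg_right hsS2 (by positivity)
  have H2 := mul_le_mul_of_nonneg_left hcG (show (0 : ℝ) ≤ Real.sqrt (25 / 8) * Real.sqrt (25 / 8) * (2 * max 2 (16 / a)) by positivity)
  have H3 : Real.sqrt (25 / 8) * Real.sqrt (25 / 8) * (2 * max 2 (16 / a)) * (P₁ * ν + P₂ * ε₀ * ((Rb : ℝ) + 9 + (F.L : ℝ) ^ 2))
      = 25 / 8 * (2 * max 2 (16 / a)) * (P₁ * ν + P₂ * ε₀ * ((Rb : ℝ) + 9 + (F.L : ℝ) ^ 2)) := by rw [hss]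
  have H4 : Real.sqrt (25 / 8) * Real.sqrt (25 / 8) * (144 * max 2 (16 / a) ^ 2 * Real.exp (-(μa * ((Bt - 1) / ν))))
      = 25 / 8 * (144 * max 2 (16 / a) ^ 2 * Real.exp (-(μa * ((Bt - 1) / ν)))) := by rw [hss]
  have N1 : 0 ≤ max 2 (16 / a) ^ 2 * (ε₀ * ((Rb : ℝ) + 9)) := by positivity
  have N2 : 0 ≤ max 2 (16 / a) ^ 2 * ((F.L : ℝ) ^ 2 * ε₀) := by positivity
  linarith only [H1, H2, H3, H4, N1, N2]

/-- The seven coefficients of `cG_le`∕`cQ_le`∕`epsN_le` are nonnegative (hypotheses `hPG₁ … hTN` of ✓`Prop7LODBudgetLetters.exists_budget_letters`). -/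
theorem coeff_nonneg {a : ℝ} (ha : 0 < a) :
    0 ≤ (Real.sqrt (max 2 (16 / a)) * (1 + Real.sqrt (max 2 (16 / a))) * (8 * (Real.sqrt (max 2 (16 / a)) + max 2 (16 / a)) + 38 * a * max 2 (16 / a))) ∧ 0 ≤ (Real.sqrt (max 2 (16 / a)) * (1 + Real.sqrt (max 2 (16 / a))) * (20 * (Real.sqrt (max 2 (16 / a)) + max 2 (16 / a)) + 54576 * a * max 2 (16 / a))) ∧ 0 ≤ (13500 * max 2 (16 / a)) ∧ 0 ≤ (32 * max 2 (16 / a)) ∧ 0 ≤ (25 / 4 * max 2 (16 / a) * (Real.sqrt (max 2 (16 / a)) * (1 + Real.sqrt (max 2 (16 / a))) * (8 * (Real.sqrt (max 2 (16 / a)) + max 2 (16 / a)) + 38 * a * max 2 (16 / a)))) ∧ 0 ≤ (25 / 4 * max 2 (16 / a) * (Real.sqrt (max 2 (16 / a)) * (1 + Real.sqrt (max 2 (16 / a))) * (20 * (Real.sqrt (max 2 (16 / a)) + max 2 (16 / a)) + 54576 * a * max 2 (16 / a))) + 54576 * max 2 (16 / a) ^ 2) ∧ 0 ≤ (450 * max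 2 (16 / a) ^ 2) := by
  have hM0 : (0 : ℝ) ≤ max 2 (16 / a) := le_trans (by norm_num) (le_max_left _ _)
  have hr0 : 0 ≤ Real.sqrt (max 2 (16 / a)) := Real.sqrt_nonneg _
  refine ⟨?_, ?_, ?_, ?_, ?_, ?_, ?_⟩ <;> positivity

end Summit.QuantumFields.YangMills.Theorems.Prop7LocalProjectorRowCubeLetterBounds

end
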